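import Summits.NavierStokesRegularity.FluidComputer.PalasekTowerClayBridge
import Summits.NavierStokesRegularity.FluidComputer.SerrinDivergenceMaximalForced
import Summits.NavierStokesRegularity.FluidComputer.ClayForceSliceBounds
import Literature.Analysis.FluidPDE.NSForcedH1Continuation
import HarnessLib

/-!
# A realised Palasek tower leaves every Serrin class and is not sub-Type-I
# (the `E–C` endpoint tests R2 / K2-F and the Type-II floor as THEOREMS about the interface)

HONEST FRAMING (cell `ns-blowup`, seat `ns-blowup-ecbridge-2` g0, human ruling D-0035): nothing here
asserts that a realisation exists (`PalasekStep2` is open and is NOT assumed); this file says what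
ANY inhabitant of the interface `PalasekTowerClayBridge.Realisation ν R` (seat ecbridge-1) must look
like near its blow-up time. WHAT THIS IS NOT: not NS evidence either way.

Joint item of the seats ecbridge-1 / ecbridge-2 (cell STATUS ll.714, 759, 838, 908; memo
`run/shared/lean/pub/ns-blowup/ecbridge2/ECBRIDGE-2-MEMO-1.md` §7). For a realisation `W` (exact
classical forced Navier–Stokes on `[0, T)`, Clay datum and Clay force, floors forcing a genuine
loss of smoothness at `T`: `W.isMaximalSmoothSolution`) and ANY pressure field `p'` for which
`(W.u, p')` is classical on `[0, T)` and lies, with `∂ₜu` and `p'`, in Tao's `L²`-Sobolev class on every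
closed sub-slab (for the NORMALISED pressure this is Tao 2013 Cor. 11.1 + Thm. 5.4 (iv) with force,
the named fact `tao2011_hasBoundedSobolevNormsOn_forced`; it is taken here as hypotheses on `p'` so
that no pressure normalisation enters this file), and GIVEN the forced `H¹` continuation
(`lemarieRieusset2016_H1_continuation_forced`, Lemarié-Rieusset 2016 Thm. 7.2, a named fact — the
one printed input of the argument):

* `Realisation.lintegral_serrin_eq_top` — `∫₀ᵀ ‖u(t)‖_{L^r}^{2/(1-3/r)} dt = ∞` for EVERY `3 < r ≤ ∞`:
  the velocity of a realised tower leaves every Ladyzhenskaya–Prodi–Serrin class at `T`;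
* `Realisation.not_subTypeI` — no bound `‖u(t)‖_∞ ≤ C (T - t)^{-γ}` with `γ < 1/2` on `(0, T)`:
  a realised tower is at least Type I (it is in fact Type II by design, `TowerRates.typeII_exponent`).

Ingredients, all in the tree: the PROVED forced Serrin machinery
`SerrinDivergenceMaximalForced.lintegral_serrin_eq_top_of_isMaximalSmoothSolution` /
`.not_subTypeI_of_isMaximalSmoothSolution` (on `Literature.Analysis.FluidPDE.enstrophy_le_of_serrin_forced_uniform`,
Lemarié-Rieusset (11.11) with force), the force-side plumbing `ClayForceSliceBounds.clayForce_slice_bounds`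
(Clay force ⇒ slice `L²`/`Ḣ¹` bounds, constant majorant), and `Realisation.isMaximalSmoothSolution`.
-/

noncomputable section

namespace Summit.NavierStokesRegularity.FluidComputer.PalasekTowerClayBridge

namespace Realisation

open Set MeasureTheory Function Literature.Analysis.FluidPDE
open scoped ENNReal NNReal

variable {ν : ℝ} {R : TowerRates} (W : Realisation ν R)

/-- The forced `H¹` continuation fact, specialised to a realisation with a Tao-class pressure
field `p'`: bounded enstrophy on `[0, T)` would extend the flow smoothly past `T`. -/
theorem hasSmoothExtensionPast_of_enstrophy_bounded
    (hC : lemarieRieusset2016_H1_continuation_forced) (hν : 0 < ν)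
    {p' : ℝ → EuclideanSpace ℝ (Fin 3) → ℝ}
    (hsol : IsClassicalNSSolutionOn (Ico 0 W.T) ν W.f W.u p')
    (hu : ∀ T' ∈ Ioo 0 W.T, HasBoundedSobolevNormsOn (Icc 0 T') W.u)
    (hut : ∀ T' ∈ Ioo 0 W.T, HasBoundedSobolevNormsOn (Icc 0 T') (timeDerivWithin (Icc 0 T') W.u))
    (hB : ∃ B : ℝ≥0, ∀ t ∈ Ico 0 W.T,
      ∫⁻ x, ENNReal.ofReal (frobeniusNormSq (fderiv ℝ (W.u t) x)) ≤ B) :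
    HasSmoothExtensionPast ν W.f W.u W.T :=
  hC hν W.T_pos hsol hu hut (fun T' hT' => W.energy T' hT'.2) W.datum_decay W.force_smooth
    W.force_decay hB

/-- **A realised tower leaves every Serrin class at its blow-up time.** For a realisation `W`
and a pressure field `p'` with `(W.u, p')` classical on `[0, T)` and in Tao's class on every closed
sub-slab (`u`, `∂ₜu`, `p'`), given the forced `H¹` continuation fact: for every `3 < r ≤ ∞`,
`∫₀ᵀ ‖u(t)‖_{L^r}^{2/(1 - 3/r)} dt = ∞` (time exponent `2/(1 - (3/r).toReal)`, `= 2` for `r = ∞`). -/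
theorem lintegral_serrin_eq_top (hC : lemarieRieusset2016_H1_continuation_forced) (hν : 0 < ν)
    {p' : ℝ → EuclideanSpace ℝ (Fin 3) → ℝ}
    (hsol : IsClassicalNSSolutionOn (Ico 0 W.T) ν W.f W.u p')
    (hu : ∀ T' ∈ Ioo 0 W.T, HasBoundedSobolevNormsOn (Icc 0 T') W.u)
    (hut : ∀ T' ∈ Ioo 0 W.T, HasBoundedSobolevNormsOn (Icc 0 T') (timeDerivWithin (Icc 0 T') W.u))
    (hp : ∀ T' ∈ Ioo 0 W.T, ∀ n : ℕ, ∃ C : ℝ≥0, ∀ t ∈ Icc 0 T',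
      ∫⁻ x, ‖iteratedFDeriv ℝ n (p' t) x‖ₑ ^ 2 ≤ C)
    {r : ℝ≥0∞} (hr : 3 < r) :
    ∫⁻ t in Ioo 0 W.T,
        ENNReal.ofReal ((eLpNorm (W.u t) r volume).toReal ^ (2 / (1 - (3 / r).toReal))) = ⊤ := by
  -- maximality with the pressure `p'` (maximality is a property of the velocity)
  have hmax : IsMaximalSmoothSolution ν W.f W.u p' W.T := ⟨hsol, W.isMaximalSmoothSolution.2⟩
  -- the force side: slice bounds and the constant majorant
  obtain ⟨⟨C₀, hC₀⟩, ⟨C₁, hC₁⟩⟩ :=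
    ClayForceSliceBounds.clayForce_slice_bounds W.force_smooth W.force_decay
  have hf : ∀ T' ∈ Ioo 0 W.T, ∀ n : ℕ, n ≤ 1 → ∃ C : ℝ≥0, ∀ t ∈ Icc 0 T',
      ∫⁻ x, ‖iteratedFDeriv ℝ n (W.f t) x‖ₑ ^ 2 ≤ C := by
    intro T' _ n hn
    interval_cases n
    · refine ⟨C₀, fun t ht => ?_⟩
      have h := hC₀ t ht.1
      refine le_trans (le_of_eq (lintegral_congr fun x => ?_)) h
      rw [← ofReal_norm, ← ofReal_norm, norm_iteratedFDeriv_zero]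
    · exact ⟨C₁, fun t ht => hC₁ t ht.1⟩
  have hFT : ∫⁻ t in Ioo 0 W.T, (C₀ : ℝ≥0∞) ≠ ⊤ := by
    rw [setLIntegral_const]
    exact ENNReal.mul_ne_top ENNReal.coe_ne_top (by simp [Real.volume_Ioo])
  exact SerrinDivergenceMaximalForced.lintegral_serrin_eq_top_of_isMaximalSmoothSolution hν W.T_pos
    hmax hu hut hp hf (fun _ => (C₀ : ℝ≥0∞)) measurable_const (fun t ht => hC₀ t ht.1.le) hFT
    (W.hasSmoothExtensionPast_of_enstrophy_bounded hC hν hsol hu hut) hr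

/-- **A realised tower is not sub-Type-I.** Same hypotheses; then no `C` and `γ < 1/2` with
`‖u(t)‖_{L^∞} ≤ C (T - t)^{-γ}` for all `t ∈ (0, T)` (Type I, `γ = 1/2`, is the borderline; the
interface's own floor makes the tower Type II, `TowerRates.typeII_exponent`). -/
theorem not_subTypeI (hC : lemarieRieusset2016_H1_continuation_forced) (hν : 0 < ν)
    {p' : ℝ → EuclideanSpace ℝ (Fin 3) → ℝ}
    (hsol : IsClassicalNSSolutionOn (Ico 0 W.T) ν W.f W.u p')
    (hu : ∀ T' ∈ Ioo 0 W.T, HasBoundedSobolevNormsOn (Icc 0 T') W.u)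
    (hut : ∀ T' ∈ Ioo 0 W.T, HasBoundedSobolevNormsOn (Icc 0 T') (timeDerivWithin (Icc 0 T') W.u))
    (hp : ∀ T' ∈ Ioo 0 W.T, ∀ n : ℕ, ∃ C : ℝ≥0, ∀ t ∈ Icc 0 T',
      ∫⁻ x, ‖iteratedFDeriv ℝ n (p' t) x‖ₑ ^ 2 ≤ C)
    {C γ : ℝ} (hCγ : 0 ≤ C) (hγ : γ < 1 / 2)
    (hrate : ∀ t ∈ Ioo 0 W.T, eLpNorm (W.u t) ⊤ volume ≤ ENNReal.ofReal (C * (W.T - t) ^ (-γ))) :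
    False := by
  have hmax : IsMaximalSmoothSolution ν W.f W.u p' W.T := ⟨hsol, W.isMaximalSmoothSolution.2⟩
  obtain ⟨⟨C₀, hC₀⟩, ⟨C₁, hC₁⟩⟩ :=
    ClayForceSliceBounds.clayForce_slice_bounds W.force_smooth W.force_decay
  have hf : ∀ T' ∈ Ioo 0 W.T, ∀ n : ℕ, n ≤ 1 → ∃ C : ℝ≥0, ∀ t ∈ Icc 0 T',
      ∫⁻ x, ‖iteratedFDeriv ℝ n (W.f t) x‖ₑ ^ 2 ≤ C := by
    intro T' _ n hn
    interval_cases n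
    · refine ⟨C₀, fun t ht => ?_⟩
      have h := hC₀ t ht.1
      refine le_trans (le_of_eq (lintegral_congr fun x => ?_)) h
      rw [← ofReal_norm, ← ofReal_norm, norm_iteratedFDeriv_zero]
    · exact ⟨C₁, fun t ht => hC₁ t ht.1⟩
  have hFT : ∫⁻ t in Ioo 0 W.T, (C₀ : ℝ≥0∞) ≠ ⊤ := by
    rw [setLIntegral_const]
    exact ENNReal.mul_ne_top ENNReal.coe_ne_top (by simp [Real.volume_Ioo])
  exact SerrinDivergenceMaximalForced.not_subTypeI_of_isMaximalSmoothSolution hν W.T_pos hmax hu hut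
    hp hf (fun _ => (C₀ : ℝ≥0∞)) measurable_const (fun t ht => hC₀ t ht.1.le) hFT
    (W.hasSmoothExtensionPast_of_enstrophy_bounded hC hν hsol hu hut) hCγ hγ hrate

end Realisation

end Summit.NavierStokesRegularity.FluidComputer.PalasekTowerClayBridge

end
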